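import Summits.ResolutionOfSingularities.ResolutionOfSingularities.Theorems.PurelyInseparableDim4JointMixedChild
import Summits.ResolutionOfSingularities.ResolutionOfSingularities.Theorems.PurelyInseparableDim4JointMixedLeaf
import Summits.ResolutionOfSingularities.ResolutionOfSingularities.Theorems.PurelyInseparableDim4JointForestDepthTwoKit
import HarnessLib

/-!
# Purely inseparable four-folds: the MIXED certificate — a 3-fold blow-up over which a SURFACE CHILD and an isolated LEAF are
# handled AT THE SAME STAGE (brick S3 (c) «joint point∘coordinate chains», part 30c, cell `res-dim4-pi`)

[OURS · counted 0] (D-0157 DOOR 2; desk WORD #66 (4)(c), #74 (g), #99 (d), #101 (c); frame `PIDim4.TerminationImpliesOrderReduction`,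
S3 (c); host item stmt-ResolutionOfSingularities-16155, helper). Nothing here proves resolution of singularities in
dimension ≥ 4 / characteristic `p` — NOT here, not anywhere in this programme; ONE explicit hypersurface family is resolved.

* **`exists_isMarkedResolution_inst₉`** — over `K = K̄` of characteristic `p ≥ 3`,
  `(𝔸⁵_K, (z^p + x₁^p·((x₂² − x₂)^p x₃ + (x₂x₃)^p x₄ + (x₂x₄)^p x₁ + x₁^p x₂))·𝒪, [], p)` admits a marked resolution (BGMW Def. 3.1.3):
  the depth-two certificate kit (part 27) with the member `(0, {x₁})` (roots: part 30a), ONE planned entry `(x₁, 0, {x₁, x₂})` — the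
  surface child `{y₂ = 0}` of the exceptional hyperplane, permissible and DEAD (part 30a′) — and ONE leaf `(x₁, (0,1,0,0))`, DEAD for the
  point centre (part 30b); the normalised cover is `cases_of_isEquimultiplePoint_F_mixed`. The first certificate in which a positive-
  dimensional child and an isolated point are handed over SIMULTANEOUSLY over one member. UNCONDITIONAL.

AI-produced formalisation, weaker than expert review. bears_on: LADDER-RESOLUTION:D157-DOOR2 (res-dim4-pi · S3 (c) joint v2 · mixed
instance, certificate).
-/

set_option linter.dupNamespace false -- D-0017: single-problem summit path `Summit.<S>.<S>.…` by design

noncomputable section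

open MvPolynomial Finset CategoryTheory AlgebraicGeometry Opposite TopologicalSpace

namespace Summit.ResolutionOfSingularities.ResolutionOfSingularities.Theorems.PIDim4

open Literature.AlgebraicGeometry.Resolution
open Literature.AlgebraicGeometry.Resolution.Hauser2010
open Literature.AlgebraicGeometry.Resolution.AffinePointBlowup (P A γ coord Wtop ξ)

namespace Equimultiple

section Instance₉

variable {K : Type} [Field K] {p : ℕ} [hp : Fact p.Prime] [CharP K p]

/-- **`z^p + x₁^p((x₂² − x₂)^p x₃ + (x₂x₃)^p x₄ + (x₂x₄)^p x₁ + x₁^p x₂)` ADMITS A MARKED RESOLUTION** (`K = K̄`, characteristic `p ≥ 3`):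
blow up the 3-fold `V(z, x₁)`; over it blow up the surface child `V(z, y₁, y₂)` and the isolated point `(0, 1, 0, 0)` of the exceptional
hyperplane (disjoint centres, glued); nothing of order `p` survives. [cite: BierstoneGrigorievMilmanWlodarczyk2011, Def. 3.1.3]
[cite: HauserPerlega2019PRIMS, §2] [cite: Hauser2010, §F (equiconstant points)] -/
theorem exists_isMarkedResolution_inst₉ [IsAlgClosed K] [DecidableEq K] (hp3 : 3 ≤ p) :
    ∃ (X' : Scheme.{0}) (ρ : X' ⟶ P 4 K) (M' : MarkedIdeal X'),
      IsMarkedResolution (⟨hypSheaf p (X 0 ^ p * (X 1 ^ (2 * p) * X 2 - X 1 ^ p * X 2 + X 1 ^ p * X 2 ^ p * X 3 + X 0 * X 1 ^ p * X 3 ^ p +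
        X 0 ^ p * X 1) : MvPolynomial (Fin 4) K), [], p⟩ : MarkedIdeal (P 4 K)) ρ M' := by
  classical
  have hG₀ : deletePthPowers p (PointBlowup.translate (0 : Fin 4 → K)
      (X 0 ^ p * (X 1 ^ (2 * p) * X 2 - X 1 ^ p * X 2 + X 1 ^ p * X 2 ^ p * X 3 + X 0 * X 1 ^ p * X 3 ^ p + X 0 ^ p * X 1) :
        MvPolynomial (Fin 4) K)) =
      X 0 ^ p * (X 1 ^ (2 * p) * X 2 - X 1 ^ p * X 2 + X 1 ^ p * X 2 ^ p * X 3 + X 0 * X 1 ^ p * X 3 ^ p + X 0 ^ p * X 1) := by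
    rw [PointBlowup.translate_zero]
    exact Literature.Barriers.ResolutionOfSingularities.HauserPerlega.deletePthPowers_eq_self isClean_F_mixed
  refine exists_isMarkedResolution_depth_two_cert (p := p)
    (X 0 ^ p * (X 1 ^ (2 * p) * X 2 - X 1 ^ p * X 2 + X 1 ^ p * X 2 ^ p * X 3 + X 0 * X 1 ^ p * X 3 ^ p + X 0 ^ p * X 1))
    F_mixed_ne_zero isClean_F_mixed (0 : Fin 4 → K) ({0} : Finset (Fin 4))
    ⟨X 0 ^ p * (X 1 ^ (2 * p) * X 2 - X 1 ^ p * X 2 + X 1 ^ p * X 2 ^ p * X 3 + X 0 * X 1 ^ p * X 3 ^ p + X 0 ^ p * X 1), 0, ∅⟩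
    (by rw [hG₀]) isPermissibleCentre_F_mixed (fun b' H i hi => ?_)
    {((0 : Fin 4), (0 : Fin 4 → K), ({0, 1} : Finset (Fin 4)))} {((0 : Fin 4), (Pi.single 1 1 : Fin 4 → K))}
    (fun e he => ?_) (fun e he e' he' hne => ?_) (fun j' b' hj' hb' _ heq => ?_) (fun e he j'' b'' hj'' hb'' => ?_)
    (fun l hl k c hck => ?_)
  · -- root parameters on the member
    rw [Finset.mem_singleton] at hi
    subst hi
    exact roots_F_mixed b' H
  · -- the planned entry: in the frame, equimultiple, permissible child
    rw [Finset.mem_singleton] at he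
    subst he
    refine ⟨Finset.mem_singleton_self _, rfl, Finset.singleton_subset_iff.mpr (Finset.mem_insert_self _ _),
      isEquimultiplePoint_F_mixed_origin, ?_⟩
    rw [step_F_mixed_zero]
    exact isPermissibleCentre_pair_G_mixed
  · -- one entry only
    rw [Finset.mem_singleton] at he he'
    exact absurd (he.trans he'.symm) hne
  · -- normalised cover: the surface `{y₂ = 0}` or the point `(0, 1, 0, 0)`
    rw [Finset.mem_singleton] at hj'
    subst hj'
    rcases cases_of_isEquimultiplePoint_F_mixed hb' heq with h1 | h1
    · left
      refine ⟨((0 : Fin 4), (0 : Fin 4 → K), ({0, 1} : Finset (Fin 4))), Finset.mem_singleton_self _, rfl, fun i hi => ?_⟩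
      rcases Finset.mem_insert.mp hi with rfl | hi
      · exact hb'
      · rw [Finset.mem_singleton] at hi
        subst hi
        exact h1
    · right
      rw [h1]
      exact Finset.mem_singleton_self _
  · -- the child is dead
    rw [Finset.mem_singleton] at he
    subst he
    exact not_isEquimultiplePoint_child_mixed hp3 hj'' b'' hb'' _ step_F_mixed_zero
  · -- the leaf is dead
    rw [Finset.mem_singleton] at hl
    subst hl
    exact not_isEquimultiplePoint_L_mixed hp3 k c hck _ step_F_leaf_mixed

end Instance₉

end Equimultiple

end Summit.ResolutionOfSingularities.ResolutionOfSingularities.Theorems.PIDim4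

end
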